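import Mathlib.NumberTheory.NumberField.InfiniteAdeleRing
import HarnessLib

/-!
# Elements of a number field with prescribed signs at the real places

Weak approximation at the infinite places (Mathlib's `NumberField.InfiniteAdeleRing.denseRange_algebraMap`:
`K` is dense in `K_∞ = ∏_{w ∣ ∞} K_w`) gives, for every set `N` of places, a nonzero `b ∈ K` which is
NEGATIVE at the real places in `N` and POSITIVE at the other real places
(`exists_forall_isReal_sign`).  The signs are read through the canonical isomorphisms
`K_w →+* ℝ` (`InfinitePlace.Completion.extensionEmbeddingOfIsReal`), the currency of the tree's
archimedean reciprocity lemmas (`BrauerSumInvCyclicClassPositive.lean`); the `embedding_of_isReal`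
form follows from `extensionEmbeddingOfIsReal_coe`.  This is the arithmetic input of the correction at
the real places in Tate's reciprocity law for the `2`-primary part over fields with real places.

## References

* J. Neukirch, *Algebraic Number Theory* (1999), Ch. II §3 (3.4) (approximation theorem), Ch. VI §5. [NeukirchANT1999]
-/

noncomputable section

open NumberField

namespace Literature.NumberTheory.NumberFields

variable (K : Type*) [Field K] [NumberField K]

/-- **Prescribed signs at the real places.**  For every set `N` of infinite places of the number field
`K` there is `b ∈ K`, `b ≠ 0`, with `b <_w 0` at the real places `w ∈ N` and `b >_w 0` at the real
places `w ∉ N` (signs read in `K_w ≅ ℝ`).  Proof: the set of `x ∈ K_∞` with the prescribed signs at the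
real places and nonzero components at the complex ones is open and nonempty, and `K` is dense in `K_∞`
(weak approximation). [cite: NeukirchANT1999, Ch. II §3 Thm. (3.4)] -/
theorem exists_forall_isReal_sign (N : Set (InfinitePlace K)) :
    ∃ b : K, b ≠ 0 ∧ ∀ (w : InfinitePlace K) (hw : w.IsReal),
      (w ∈ N → InfinitePlace.Completion.extensionEmbeddingOfIsReal hw (algebraMap K w.Completion b) < 0) ∧
      (w ∉ N → 0 < InfinitePlace.Completion.extensionEmbeddingOfIsReal hw (algebraMap K w.Completion b)) := by
  classical
  -- the target open set, place by place
  let U : (w : InfinitePlace K) → Set w.Completion := fun w =>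
    if hw : w.IsReal then
      (if w ∈ N then {x | InfinitePlace.Completion.extensionEmbeddingOfIsReal hw x < 0}
        else {x | 0 < InfinitePlace.Completion.extensionEmbeddingOfIsReal hw x})
    else {x | x ≠ 0}
  have hUopen : ∀ w, IsOpen (U w) := by
    intro w
    by_cases hw : w.IsReal
    · have hc := (InfinitePlace.Completion.isometry_extensionEmbeddingOfIsReal hw).continuous
      by_cases hN : w ∈ N
      · simp only [U, dif_pos hw, if_pos hN]
        exact isOpen_Iio.preimage hc
      · simp only [U, dif_pos hw, if_neg hN]
        exact isOpen_Ioi.preimage hc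
    · simp only [U, dif_neg hw]
      exact isOpen_compl_singleton
  have hUne : ∀ w, (U w).Nonempty := by
    intro w
    by_cases hw : w.IsReal
    · by_cases hN : w ∈ N
      · obtain ⟨x, hx⟩ := InfinitePlace.Completion.surjective_extensionEmbeddingOfIsReal hw (-1)
        refine ⟨x, ?_⟩
        simp only [U, dif_pos hw, if_pos hN, Set.mem_setOf_eq, hx]
        norm_num
      · obtain ⟨x, hx⟩ := InfinitePlace.Completion.surjective_extensionEmbeddingOfIsReal hw 1
        refine ⟨x, ?_⟩
        simp only [U, dif_pos hw, if_neg hN, Set.mem_setOf_eq, hx]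
        norm_num
    · exact ⟨1, by simp only [U, dif_neg hw, Set.mem_setOf_eq]; exact one_ne_zero⟩
  set V : Set (InfiniteAdeleRing K) := Set.pi Set.univ U with hV
  have hVopen : IsOpen V := isOpen_set_pi Set.finite_univ fun w _ => hUopen w
  have hVne : V.Nonempty := Set.univ_pi_nonempty_iff.mpr hUne |>.mono le_rfl
  obtain ⟨b, hb⟩ := (InfiniteAdeleRing.denseRange_algebraMap (K := K)).exists_mem_open hVopen hVne
  have hbw : ∀ w, algebraMap K w.Completion b ∈ U w := fun w => hb w (Set.mem_univ w)
  obtain ⟨w₀⟩ := (inferInstance : Nonempty (InfinitePlace K))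
  refine ⟨b, fun h0 => ?_, fun w hw => ⟨fun hN => ?_, fun hN => ?_⟩⟩
  · have h := hbw w₀
    rw [h0, map_zero] at h
    by_cases hw : w₀.IsReal
    · by_cases hN : w₀ ∈ N
      · simp only [U, dif_pos hw, if_pos hN, Set.mem_setOf_eq, map_zero, lt_self_iff_false] at h
      · simp only [U, dif_pos hw, if_neg hN, Set.mem_setOf_eq, map_zero, lt_self_iff_false] at h
    · simp only [U, dif_neg hw, Set.mem_setOf_eq, ne_eq, not_true_eq_false] at h
  · have h := hbw w
    simp only [U, dif_pos hw, if_pos hN, Set.mem_setOf_eq] at h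
    exact h
  · have h := hbw w
    simp only [U, dif_pos hw, if_neg hN, Set.mem_setOf_eq] at h
    exact h

end Literature.NumberTheory.NumberFields

end
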